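import Mathlib.Data.Finset.Card
import Mathlib.Data.List.Chain
import Mathlib.Logic.Relation
import Mathlib.Logic.Function.Basic
import Literature.Computability.MetaComplexity.ResLin
import Literature.Computability.MetaComplexity.ResLinProofs
import Literature.Computability.MetaComplexity.RevResLin
import Literature.Computability.MetaComplexity.ResLinSpace
import HarnessLib

/-!
# Linear clause space always suffices for Res(⊕)

The Res(⊕) form of the Esteban–Torán upper bound for resolution clause space [Esteban–Torán
1999/2001, as stated in Alekhnovich–Ben-Sasson–Razborov–Wigderson 2002, Thm. 3.5: "If T is a
contradictory set of clauses over n variables, then CSpace(T) ≤ n + 1", by pebbling the complete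
decision tree depth-first]: every unsatisfiable CNF `φ`
has a configuration-style Res(⊕) refutation (`IsResLinSpaceRefutation`, download / erase / one-rule
inference, `Literature/Computability/MetaComplexity/ResLinSpace.lean`) of clause space at most
`numVars φ + 2`:

* `exists_isResLinSpaceRefutation_le_numVars` and `minResLinClauseSpace_le_numVars_add_two`.

Together with the space–width relation (`ResLinSpaceWidth.lean`, Gryaznov–Ovcharov–Riazanov 2024,
Thm 6) this makes linear clause-space bounds for Res(⊕) (e.g. for random 3-CNF) tight up to the
constant. The construction is the depth-first pebbling of the decision tree, phrased with the POINT
CLAUSES `pointClause k a = ⋁_{i<k} (xᵢ = ¬aᵢ)` of `RevResLin.lean`: to put `pointClause k a` into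
memory, recursively put `pointClause (k+1) a[k↦0]` and `pointClause (k+1) a[k↦1]` there (the second
while holding the first, one extra cell), resolve them on `x_k`, and erase the two premises; at the
leaves (`k = numVars φ`) download a clause of `φ` falsified by `a` and weaken it to the point clause.

## References

* J. L. Esteban, J. Torán, *Space bounds for resolution*, Inform. Comput. 171 (2001) (the upper
  bound `CSpace ≤ n + 1`; conference version STACS 1999) [EstebanToran2001]; quoted as Thm. 3.5 of
  M. Alekhnovich, E. Ben-Sasson, A. Razborov, A. Wigderson, SIAM J. Comput. 31 (2002)
  [AlekhnovichBenSassonRazborovWigderson2002].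
* S. Gryaznov, S. Ovcharov, A. Riazanov, ACM ToCT 16(3) (2024), §2.4 (Res(⊕) clause space)
  [GryaznovOvcharovRiazanov2024].
-/

namespace Literature.Computability.MetaComplexity

open _root_.Computability Complexity

/-! ### Point clauses one variable up -/

/-- Monotonicity of reflexive–transitive closure in the relation (helper, stated pointwise).
[folklore] -/
private theorem reflTransGen_of_imp_cfg {α : Type*} {r p : α → α → Prop} (H : ∀ a b, r a b → p a b)
    {a b : α} (h : Relation.ReflTransGen r a b) : Relation.ReflTransGen p a b := by
  induction h with
  | refl => exact Relation.ReflTransGen.refl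
  | tail _ hbc ih => exact ih.tail (H _ _ hbc)

/-- `pointClause (k+1) (a[k ↦ b]) = pointClause k a ∨ (x_k = ¬b)`. [folklore] -/
private theorem pointClause_succ_update (k : ℕ) (a : ℕ → Bool) (b : Bool) :
    pointClause (k + 1) (Function.update a k b) = insert (({k} : Finset ℕ), !b) (pointClause k a) := by
  rw [pointClause_succ, Function.update_self]
  congr 1
  exact pointClause_congr fun i hi => Function.update_of_ne (Nat.ne_of_lt hi) _ _

/-- An initial clause falsified by `a` implies the full point clause of `a`. [Alekseev–Gaevoy 2026,
Def 11 (completeness of blackboard systems); folklore] [folklore] -/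
private theorem toLinClause_imp_pointClause {φ : CNF ℕ} {c : Clause ℕ} (hc : c ∈ φ) {a : ℕ → Bool}
    (ha : Clause.eval a c = false) (σ : ℕ → Bool) (hσ : (Clause.toLinClause c).eval σ = true) :
    (pointClause φ.numVars a).eval σ = true := by
  have h := eval_pointClause_union_toLinClause hc ha σ
  rw [LinClause.eval_union, hσ, Bool.or_true] at h
  exact h.symm

/-! ### The depth-first pebbling -/

/-- DEPTH-FIRST PEBBLING [Esteban–Torán, `CSpace ≤ n + 1` (ABRW 2002, Thm. 3.5), one system up]:
for `k + d = numVars φ` (`φ` unsatisfiable), from any memory `L` one can reach `L ∪ {pointClause k a}`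
through configurations with at most `|L| + d + 2` clauses.
[cite: AlekhnovichBenSassonRazborovWigderson2002, Thm. 3.5] -/
theorem reflTransGen_insert_pointClause {φ : CNF ℕ} (hφ : ¬ φ.Satisfiable) :
    ∀ d k : ℕ, k + d = φ.numVars → ∀ (a : ℕ → Bool) (L : Finset LinClause),
      Relation.ReflTransGen (fun M M' => ResLinSpaceStep φ M M' ∧ M'.card ≤ L.card + d + 2)
        L (insert (pointClause k a) L) := by
  classical
  intro d
  induction d with
  | zero =>
      intro k hk a L
      obtain rfl : k = φ.numVars := by simpa using hk
      set P := pointClause φ.numVars a with hP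
      by_cases hPL : P ∈ L
      · rw [Finset.insert_eq_of_mem hPL]
      -- a clause of `φ` falsified by `a`
      have hfalse : ∃ c ∈ φ, Clause.eval a c = false := by
        by_contra hcon
        refine hφ ⟨a, (CNF.eval_eq_true_iff φ a).2 fun c hc => ?_⟩
        by_contra hct
        exact hcon ⟨c, hc, by simpa using hct⟩
      obtain ⟨c, hc, hca⟩ := hfalse
      set Cc := Clause.toLinClause c with hCc
      have himp : ∀ σ : ℕ → Bool, Cc.eval σ = true → P.eval σ = true :=
        fun σ hσ => toLinClause_imp_pointClause hc hca σ hσ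
      by_cases hCL : Cc ∈ L
      · -- weaken the clause already in memory
        exact Relation.ReflTransGen.single
          ⟨ResLinSpaceStep.weaken L Cc P hCL himp,
            (Finset.card_insert_le _ _).trans (by omega)⟩
      by_cases hCP : Cc = P
      · -- downloading the clause is downloading the point clause
        refine Relation.ReflTransGen.single ⟨?_, (Finset.card_insert_le _ _).trans (by omega)⟩
        rw [← hCP, hCc]
        exact ResLinSpaceStep.download L c hc
      -- download, weaken, erase
      have h1 : Relation.ReflTransGen
          (fun M M' => ResLinSpaceStep φ M M' ∧ M'.card ≤ L.card + 0 + 2) L (insert Cc L) :=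
        Relation.ReflTransGen.single
          ⟨by rw [hCc]; exact ResLinSpaceStep.download L c hc,
            (Finset.card_insert_le _ _).trans (by omega)⟩
      have h2 : Relation.ReflTransGen
          (fun M M' => ResLinSpaceStep φ M M' ∧ M'.card ≤ L.card + 0 + 2)
          (insert Cc L) (insert P (insert Cc L)) :=
        Relation.ReflTransGen.single
          ⟨ResLinSpaceStep.weaken _ Cc P (Finset.mem_insert_self _ _) himp, by
            calc (insert P (insert Cc L)).card ≤ (insert Cc L).card + 1 := Finset.card_insert_le _ _
              _ ≤ L.card + 1 + 1 := Nat.add_le_add_right (Finset.card_insert_le _ _) 1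
              _ = L.card + 0 + 2 := by ring⟩
      have h3 : Relation.ReflTransGen
          (fun M M' => ResLinSpaceStep φ M M' ∧ M'.card ≤ L.card + 0 + 2)
          (insert P (insert Cc L)) (insert P L) := by
        have hmem : Cc ∈ insert P (insert Cc L) :=
          Finset.mem_insert_of_mem (Finset.mem_insert_self _ _)
        have heq : (insert P (insert Cc L)).erase Cc = insert P L := by
          rw [Finset.erase_insert_of_ne (Ne.symm hCP), Finset.erase_insert hCL]
        refine Relation.ReflTransGen.single ⟨?_, (Finset.card_insert_le _ _).trans (by omega)⟩
        have hstep := ResLinSpaceStep.erase (φ := φ) (insert P (insert Cc L)) Cc hmem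
        rwa [heq] at hstep
      exact (h1.trans h2).trans h3
  | succ d ih =>
      intro k hk a L
      set P := pointClause k a with hP
      by_cases hPL : P ∈ L
      · rw [Finset.insert_eq_of_mem hPL]
      -- the two children
      set P0 : LinClause := insert (({k} : Finset ℕ), true) P with hP0
      set P1 : LinClause := insert (({k} : Finset ℕ), false) P with hP1
      have e0 : pointClause (k + 1) (Function.update a k false) = P0 := by
        rw [pointClause_succ_update]; rfl
      have e1 : pointClause (k + 1) (Function.update a k true) = P1 := by
        rw [pointClause_succ_update]; rfl
      -- first child from `L`, second child from `insert P0 L`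
      have hA := ih (k + 1) (by omega) (Function.update a k false) L
      have hB := ih (k + 1) (by omega) (Function.update a k true) (insert P0 L)
      rw [e0] at hA
      rw [e1] at hB
      have hA' : Relation.ReflTransGen
          (fun M M' => ResLinSpaceStep φ M M' ∧ M'.card ≤ L.card + (d + 1) + 2) L (insert P0 L) :=
        reflTransGen_of_imp_cfg (fun _ _ hxy => ⟨hxy.1, hxy.2.trans (by omega)⟩) hA
      have hB' : Relation.ReflTransGen
          (fun M M' => ResLinSpaceStep φ M M' ∧ M'.card ≤ L.card + (d + 1) + 2)
          (insert P0 L) (insert P1 (insert P0 L)) :=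
        reflTransGen_of_imp_cfg (fun _ _ hxy => ⟨hxy.1, hxy.2.trans (by
          have := Finset.card_insert_le P0 L
          omega)⟩) hB
      -- resolve the two children on `x_k`
      set M2 := insert P1 (insert P0 L) with hM2
      have hcardM2 : M2.card ≤ L.card + 2 := by
        calc M2.card ≤ (insert P0 L).card + 1 := Finset.card_insert_le _ _
          _ ≤ L.card + 1 + 1 := Nat.add_le_add_right (Finset.card_insert_le _ _) 1
          _ = L.card + 2 := by ring
      have hC : Relation.ReflTransGen
          (fun M M' => ResLinSpaceStep φ M M' ∧ M'.card ≤ L.card + (d + 1) + 2)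
          M2 (insert P M2) := by
        refine Relation.ReflTransGen.single ⟨?_, (Finset.card_insert_le _ _).trans (by omega)⟩
        have hstep := ResLinSpaceStep.resolve (φ := φ) M2 P P ({k} : Finset ℕ)
          (Finset.mem_insert_self _ _) (Finset.mem_insert_of_mem (Finset.mem_insert_self _ _))
        rwa [Finset.union_idempotent] at hstep
      -- erase the children that were not in `L`
      have hErase : ∀ (Q : LinClause) (M : Finset LinClause), Q ∈ M → M.card ≤ L.card + 3 →
          Relation.ReflTransGen
            (fun M M' => ResLinSpaceStep φ M M' ∧ M'.card ≤ L.card + (d + 1) + 2) M (M.erase Q) := by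
        intro Q M hQ hM
        refine Relation.ReflTransGen.single ⟨ResLinSpaceStep.erase M Q hQ, ?_⟩
        have := Finset.card_erase_lt_of_mem hQ
        omega
      -- target computation
      have hcard3 : (insert P M2).card ≤ L.card + 3 :=
        (Finset.card_insert_le _ _).trans (by omega)
      have hP0ne : P0 ≠ P := by
        intro h
        have : (({k} : Finset ℕ), true) ∈ P := by rw [← h]; exact Finset.mem_insert_self _ _
        rw [hP, pointClause] at this
        simp only [Finset.mem_image, Finset.mem_range, Prod.mk.injEq] at this
        obtain ⟨i, hi, hik, -⟩ := this
        rw [Finset.singleton_inj] at hik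
        omega
      have hP1ne : P1 ≠ P := by
        intro h
        have : (({k} : Finset ℕ), false) ∈ P := by rw [← h]; exact Finset.mem_insert_self _ _
        rw [hP, pointClause] at this
        simp only [Finset.mem_image, Finset.mem_range, Prod.mk.injEq] at this
        obtain ⟨i, hi, hik, -⟩ := this
        rw [Finset.singleton_inj] at hik
        omega
      have hP01 : P1 ≠ P0 := by
        intro h
        have : (({k} : Finset ℕ), false) ∈ P0 := by rw [← h]; exact Finset.mem_insert_self _ _
        rw [hP0, Finset.mem_insert] at this
        rcases this with h' | h'
        · simp at h'
        · exact hP1ne (Finset.insert_eq_of_mem h')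
      -- Stage 1: reach `insert P M2`
      have hreach : Relation.ReflTransGen
          (fun M M' => ResLinSpaceStep φ M M' ∧ M'.card ≤ L.card + (d + 1) + 2) L (insert P M2) :=
        (hA'.trans hB').trans hC
      -- Stage 2: erase `P1` if it was not in `L`, then `P0` if it was not in `L`
      by_cases h1L : P1 ∈ L
      · have hM2' : M2 = insert P0 L := by
          rw [hM2, Finset.insert_eq_of_mem (Finset.mem_insert_of_mem h1L)]
        by_cases h0L : P0 ∈ L
        · have : insert P M2 = insert P L := by rw [hM2', Finset.insert_eq_of_mem h0L]
          rw [← this]; exact hreach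
        · have hfin : (insert P M2).erase P0 = insert P L := by
            rw [hM2', Finset.erase_insert_of_ne (Ne.symm hP0ne), Finset.erase_insert h0L]
          have hQ : P0 ∈ insert P M2 := by
            rw [hM2']; exact Finset.mem_insert_of_mem (Finset.mem_insert_self _ _)
          have := hreach.trans (hErase P0 _ hQ hcard3)
          rwa [hfin] at this
      · have hQ1 : P1 ∈ insert P M2 := Finset.mem_insert_of_mem (Finset.mem_insert_self _ _)
        have hstep1 := hreach.trans (hErase P1 _ hQ1 hcard3)
        have hfin1 : (insert P M2).erase P1 = insert P (insert P0 L) := by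
          rw [hM2, Finset.erase_insert_of_ne (Ne.symm hP1ne), Finset.erase_insert]
          rw [Finset.mem_insert, not_or]
          exact ⟨hP01, h1L⟩
        rw [hfin1] at hstep1
        by_cases h0L : P0 ∈ L
        · have : insert P (insert P0 L) = insert P L := by rw [Finset.insert_eq_of_mem h0L]
          rw [← this]; exact hstep1
        · have hQ0 : P0 ∈ insert P (insert P0 L) :=
            Finset.mem_insert_of_mem (Finset.mem_insert_self _ _)
          have hcard' : (insert P (insert P0 L)).card ≤ L.card + 3 := by
            calc (insert P (insert P0 L)).card ≤ (insert P0 L).card + 1 := Finset.card_insert_le _ _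
              _ ≤ L.card + 1 + 1 := Nat.add_le_add_right (Finset.card_insert_le _ _) 1
              _ ≤ L.card + 3 := by omega
          have hstep2 := hstep1.trans (hErase P0 _ hQ0 hcard')
          have hfin0 : (insert P (insert P0 L)).erase P0 = insert P L := by
            rw [Finset.erase_insert_of_ne (Ne.symm hP0ne), Finset.erase_insert h0L]
          rwa [hfin0] at hstep2

/-- **Linear clause space suffices** [Esteban–Torán, `CSpace ≤ n + 1` for resolution (ABRW 2002,
Thm. 3.5), for Res(⊕)]: every unsatisfiable CNF `φ` has a configuration-style Res(⊕) refutation of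
clause space at most `numVars φ + 2`. [cite: AlekhnovichBenSassonRazborovWigderson2002, Thm. 3.5] -/
theorem exists_isResLinSpaceRefutation_le_numVars {φ : CNF ℕ} (hφ : ¬ φ.Satisfiable) :
    ∃ π : List (Finset LinClause), IsResLinSpaceRefutation φ π ∧
      resLinClauseSpace π ≤ φ.numVars + 2 := by
  classical
  have h := reflTransGen_insert_pointClause hφ φ.numVars 0 (by simp) (fun _ => false) ∅
  simp only [pointClause_zero, Finset.card_empty, zero_add] at h
  obtain ⟨l, hchain, hlast⟩ := List.exists_isChain_cons_of_relationReflTransGen h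
  refine ⟨∅ :: l, ⟨List.cons_ne_nil _ _, rfl, ?_, ?_⟩, ?_⟩
  · exact hchain.imp fun _ _ hxy => hxy.1
  · rw [hlast]
    exact Finset.mem_insert_self _ _
  · rw [resLinClauseSpace_le_iff]
    refine hchain.induction (fun M => M.card ≤ φ.numVars + 2) (∅ :: l) ?_ ?_
    · intro M M' hst _
      exact hst.2
    · intro _
      simp

/-- `ℕ∞` form: `minResLinClauseSpace φ ≤ numVars φ + 2` for every unsatisfiable `φ`.
[Esteban–Torán via ABRW 2002, Thm. 3.5, for Res(⊕)] [cite: AlekhnovichBenSassonRazborovWigderson2002, Thm. 3.5] -/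
theorem minResLinClauseSpace_le_numVars_add_two {φ : CNF ℕ} (hφ : ¬ φ.Satisfiable) :
    minResLinClauseSpace φ ≤ (φ.numVars + 2 : ℕ) := by
  obtain ⟨π, hπ, hsp⟩ := exists_isResLinSpaceRefutation_le_numVars hφ
  exact (minResLinClauseSpace_le hπ).trans (by exact_mod_cast hsp)

end Literature.Computability.MetaComplexity
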